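import Summits.QuantumFields.YangMills.Theorems.BalabanUVNodesN22W1StripOnDomain
import Summits.QuantumFields.YangMills.Theorems.BalabanUVNodesN22W1StripAdmReading
import Literature.MathematicalPhysics.QuantumFieldTheory.Balaban1983to89.Node00.HistoryRecursionOfRecord

/-!
# BalabanUVNodes ∕ node N22 = NE9 — THE STRIP INDUCTION AT THE W1 OBJECT, MODULE 15′: THE CHAIN ON THE TOWERS OF THE RUNS OF RECORD `runTowers S₀`, IN THE
# FIXED-DOMAIN CURRENCY — junk-freeness (J) DISCHARGED (node00-def-W1 g4's `termlessBeyond_runTowers`), the OLDER-coupling level-T hypothesis UNIVERSAL IN THE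
# DOMAIN and node N09's `EHoloAt` family BOTH READ ON THE UNTRUNCATED TOWERS BELOW THE RUN LENGTH ONLY, at the admissible reading of record

Cell `pub-ymgap`, HUMAN RULING D-0062 (Track A), R134 ACCELERATION re-seat `pub-ymgap-dag-n22-c` (strategy s1), generation 4, module 15′ (supersedes the seat's
held module-14 draft, whose level-T hypothesis had the located ∃O shape — LOCATED-STRIP-DOMAIN on the cell bus).  THEOREMS ONLY; imports module 14′ `…N22W1StripOnDomain`
(the repaired mixed producer `stripBound_termC_of_termwise226OnOlder_eHoloAt`), module 13 `…N22W1StripAdmReading` (p482103: `pairingCoherence_ofRecordAdm`; transitively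
module 9's STRIP consumer `n22At_u3OfRecord₁₂_w1Reading_of_n18Below_stripBound` and dag-n22-e's edition-1 homes) and node00-def-W1 g4's `Node00.HistoryRecursionOfRecord`
(p481041 + v1.1 p484376: `truncRun`, `runTowers`, `termlessBeyond_runTowers`, `exists_eHoloAt_truncRun_of_lt`) BY NAME.  `--supports` K3′ (helper).

WHAT.
* §1 `termwise226OnOlder_truncRun` — the OLDER-coupling level-T hypothesis UNIVERSAL IN THE DOMAIN (module 14′ §4's `h226TOnOlder` body) for the truncated tower
  `truncRun K T` at EVERY level ⇐ the same body for `T` at the levels `k′ < K` + `0 ≤ α₆ε₂` (below the run: `truncRun_of_lt`, `termC_truncRun_of_le`; beyond: the step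
  is termless, `Hc := 0`, `Tt := 0` on the given domain, `weight_nonneg`, `H_termlessTower`).  (The `EHoloAt` family below the run length is node00-def-W1 g4's
  `exists_eHoloAt_truncRun_of_lt`, by name.)
* §2 `n22At_u3OfRecord₁₂_w1Reading_of_n18Below_termwise226OnOlder_eHoloAt` — PIN-AGNOSTIC ENGINE (module 12 §1's twin in the repaired currency): for ANY W1 reading
  `D : ReadingData F 𝔸 M`, readings of the abstract run-A slot inside the spaces of record, `h226TOnOlder` for `D.S k`, an `EHoloAt` family on
  `sfTowerOfRecord Sg Rz M (D.S k) ⟨g, β⟩ logZ`, node N18 below `k`, (C1)(C2)(J), numerals ⟹ `N22At (u3OfRecord₁₂ θ (D.u3Objects θ.γ) k)`.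
* §3 ★ `n22At_u3OfRecord₁₂_ofRecordAdm_runTowers_of_n18Below_termwise226OnOlder_eHoloAt` — AT THE ADMISSIBLE READING OF RECORD ON THE TOWERS OF THE RUNS OF RECORD
  `ReadingData.ofRecordAdm F M N (runTowers S₀) sp gauge hg T₀ hT₀ li`: NO readings clause (by type, given the INCLUSION `hspk : sp k j Y ⊆ U^c_j(Y, cs.α₀, cs.α₁)` of the
  run-length-`k` table in the space table of record — serves the tables of record, node00-def-W1 g4's generated tables `spGen` and dag-n18-d's plaquette-small tables alike),
  NO coherence clause (module 13 §1), NO (J) (`termlessBeyond_runTowers`); `h226TOnOlder` and the `EHoloAt` family asked for the UNTRUNCATED `S₀ k` at the levels `k′ < k` ONLY.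
* §4 ★ `s_N22_readingOfRecord₁₂_ofRecordAdm_runTowers_of_s_N18_termwise226OnOlder_eHoloAt` — THE ₁₂ EDGE N18 → N22 at that reading, edition-1 home (dag-n18-d g3's
  `s_N18_readingAdm₁₂_iff` home at `S F θ := runTowers (S₀ F θ)`): `S_N18 (RRec₁₂ 𝔯)` + the letter signs + per `(F, θ, k)` the EXISTENCE of the Lemma-3 ∕ N09 ∕ N10 tuple
  ⟹ `S_N22 (RRec₁₂ 𝔯)`.

HONEST FRAMING.  Count-neutral by-name knit; NOT a discharge of N22: `h226TOnOlder` is node N10's lane ([II] (2.14)–(2.26) read on a common complex domain of one OLDER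
coupling — NOT PRINTED as such; needs the B13 generator ∕ term tower of record), the `EHoloAt` family is node N09's currency, `S_N18` is node N18's stub (a hypothesis),
the numerals are the reading's, `hT₀` (admissibility preservation of `T₀`, [I] (0.21)–(0.22) ∕ Lemma 1 content) is a displayed PARAMETER of the reading, the towers `S₀`
stay parameters (ref-F STANDING CHECK (g): N22 lines at the reading of record count only with `S₀` pinned BY NAME to the cluster towers of record — NODE 00's generator of
record, not typed yet), and every statement at `ofRecordAdm` is vacuous where `AdmBg … k` is empty (ref-H READ-50 A1 WATCH: nonemptiness at the spaces of record is
`AdmBg.nonempty_of_mem` + `Node00.one_mem_spaceI_stage12`, K0′-conditional); no inhabitant of `IsDatumOfRecord₁₂C` claimed (K0′).  NE5 ∕ NE9 NOT IN PRINT; one finite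
four-torus programme at fixed ε — NOT infinite volume, NOT OS on ℝ⁴, NOT a mass gap, NOT Clay.  0 `sorry`, 0 `def`, standard axioms.

References (TYPES only): [I] = [Balaban1987RG1] (0.23)–(0.25) pp. 256–257, Thm 1 p. 259, (1.18) p. 263, pp. 266–267; [II] = [Balaban1988RG2Cluster] (2.13)–(2.15)
pp. 14–15, (2.26) p. 17, Lemma 3 p. 20, (2.40)–(2.41) p. 21.
-/

noncomputable section

open scoped Matrix.Norms.L2Operator

namespace YMDAG.N22.W1

open Set Metric
open scoped BigOperators
open Literature.MathematicalPhysics.QuantumFieldTheory.Balaban1983to89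
open Literature.MathematicalPhysics.QuantumFieldTheory.Balaban1983to89.T4Continuum
open Literature.MathematicalPhysics.QuantumFieldTheory.Balaban1983to89.T4OutputRate
open Literature.MathematicalPhysics.QuantumFieldTheory.Balaban1983to89.TreeLengthTorus (TPt TDom tsys torusTreeLen torusTreeLen_nonneg)
open Literature.MathematicalPhysics.QuantumFieldTheory.Balaban1983to89.B12TreeDecay (K₀ K₀_pos)
open Literature.MathematicalPhysics.QuantumFieldTheory.Balaban1983to89.B13Lemma3TorusData (TBond)
open Literature.MathematicalPhysics.QuantumFieldTheory.Balaban1983to89.B13Lemma3TorusTerms (terms weight weight_nonneg)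
open Literature.MathematicalPhysics.QuantumFieldTheory.Balaban1983to89.B13Lemma3TorusSocket (Lemma3Numerics)
open Literature.MathematicalPhysics.QuantumFieldTheory.Balaban1983to89.B12BetaHolo (EHoloAt)
open Literature.MathematicalPhysics.QuantumFieldTheory.Balaban1983to89.Step (SFConsts)
open Literature.MathematicalPhysics.QuantumFieldTheory.Balaban1983to89.Node00
  (Stage12Params IsDatumOfRecord₁₂C U3Objects₁₁ U3Letters₁₁ MatA ιSU prependCoupling)
open Literature.MathematicalPhysics.QuantumFieldTheory.Balaban1983to89.Node00.Sect2 (domSys domCount CPair ofBackgroundC spaceI domSites Setting Residual)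
open Literature.MathematicalPhysics.QuantumFieldTheory.Balaban1983to89.Node00.W1
open YMDAG.UVSplit

variable {N : ℕ} [NeZero N]

/-! ## §1 The older-coupling level-T hypothesis, universal in the domain, under run-length truncation -/

section TruncFace

variable {F : T4Family} (k : ℕ) {𝔸 : Type*} [NormedRing 𝔸] [NormedAlgebra ℂ 𝔸] [CompleteSpace 𝔸] {G : Type*} [GaugeGroup G] {M : ℕ}
  (Sg : Setting 𝔸 G) (Rz : Residual (F.P k) 𝔸) (T : ClusterTower (F.P k) 𝔸 M) (K : ℕ)

open Classical in
/-- **THE OLDER-COUPLING LEVEL-T HYPOTHESIS, UNIVERSAL IN THE DOMAIN, SURVIVES RUN-LENGTH TRUNCATION AND NEEDS THE UNTRUNCATED TOWER ONLY BELOW THE RUN LENGTH.**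
Module 14′ §4's `h226TOnOlder` body (for every open `D ⊇` the closed `r`-discs about `]0, γ]`, level `k′`, window history `g`, OLDER coupling `i < k′`, `X ∈ 𝐃_{k′+1}`, `φ` in
the space of record: the lower terms holomorphic + (1.18)-bounded ON `D` ⟹ complexified activities holomorphic, dominated termwise-(2.26) over print's `terms L M Z` ON `D`,
equal on `]0, γ]` to the step's `H` at `g|g_i := t`) for the TRUNCATED tower `truncRun K T` at every level ⇐ the same for `T` at the levels `k′ < K`, and `0 ≤ α₆ε₂`.  Below
the run length the truncated tower's steps and lower terms are `T`'s (`truncRun_of_lt`, `termC_truncRun_of_le`); beyond it the step is termless (`truncRun_of_le`,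
`H_termlessTower`) and `Hc := 0`, `Tt := 0` witness the conclusion on the given domain (`weight_nonneg`). [cite: Balaban1988RG2Cluster, (2.14)-(2.15) p.15 and (2.26) p.17; Balaban1987RG1, (0.23)-(0.24) pp.256-257] -/
theorem termwise226OnOlder_truncRun [NeZero M] {cs : SFConsts} {γ r A κ : ℝ} (c : B13.Consts) {L : ℕ} [NeZero L] {a a₅ : ℝ} (hA6 : 0 ≤ c.α₆ * c.eps2)
    (hbelow : ∀ (D : Set ℂ), IsOpen D → (∀ t ∈ Ioc (0 : ℝ) γ, closedBall (t : ℂ) r ⊆ D) →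
      ∀ (k' : ℕ), k' < K → ∀ (g : ℕ → ℝ), g ∈ Window γ → ∀ (i : ℕ), i < k' → ∀ (X : (domSys (F.P k) M (k' + 1)).Dom) (φ : CPair (F.P k) 𝔸),
      φ ∈ spaceI Sg Rz M (k' + 1) (domSites (F.P k) M (k' + 1) X) cs.α₀ cs.α₁ →
      (∀ (j : ℕ), j < k' + 1 → ∀ (Y : (domSys (F.P k) M j).Dom) (ψ : CPair (F.P k) 𝔸), ψ ∈ spaceI Sg Rz M j (domSites (F.P k) M j Y) cs.α₀ cs.α₁ →
        ∃ Ec : ℂ → ℂ, DifferentiableOn ℂ Ec D ∧ (∀ z ∈ D, ‖Ec z‖ ≤ A * Real.exp (-(κ * torusTreeLen Y.1))) ∧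
          (∀ t ∈ Ioc (0 : ℝ) γ, Ec t = termC T j Y (Function.update g i t) ψ)) →
      ∃ (Hc : ℂ → TDom 4 (domCount (F.P k) M (k' + 1)) → ℂ)
        (Tt : (Z : TDom 4 (domCount (F.P k) M (k' + 1))) →
          Finset (TDom 4 (L * domCount (F.P k) M (k' + 1))) × Finset (TBond 4 M (L * domCount (F.P k) M (k' + 1))) → ℂ → ℂ),
        (∀ Z : (domSys (F.P k) M (k' + 1)).Dom, Z.1 ⊆ X.1 → DifferentiableOn ℂ (fun z => Hc z Z) D) ∧
        (∀ z ∈ D, ∀ Z : TDom 4 (domCount (F.P k) M (k' + 1)), Z.1 ⊆ X.1 → ‖Hc z Z‖ ≤ ∑ t ∈ terms L M Z, ‖Tt Z t z‖) ∧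
        (∀ z ∈ D, ∀ Z : TDom 4 (domCount (F.P k) M (k' + 1)), Z.1 ⊆ X.1 → ∀ t ∈ terms L M Z,
          ‖Tt Z t z‖ ≤ weight L M c Z a t * Real.exp (a₅ * ((Z.1).card : ℝ))) ∧
        (∀ t ∈ Ioc (0 : ℝ) γ, Hc t = (T k').H (restrictPrefix k' (Function.update g i t)) φ)) :
    ∀ (D : Set ℂ), IsOpen D → (∀ t ∈ Ioc (0 : ℝ) γ, closedBall (t : ℂ) r ⊆ D) →
      ∀ (k' : ℕ) (g : ℕ → ℝ), g ∈ Window γ → ∀ (i : ℕ), i < k' → ∀ (X : (domSys (F.P k) M (k' + 1)).Dom) (φ : CPair (F.P k) 𝔸),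
      φ ∈ spaceI Sg Rz M (k' + 1) (domSites (F.P k) M (k' + 1) X) cs.α₀ cs.α₁ →
      (∀ (j : ℕ), j < k' + 1 → ∀ (Y : (domSys (F.P k) M j).Dom) (ψ : CPair (F.P k) 𝔸), ψ ∈ spaceI Sg Rz M j (domSites (F.P k) M j Y) cs.α₀ cs.α₁ →
        ∃ Ec : ℂ → ℂ, DifferentiableOn ℂ Ec D ∧ (∀ z ∈ D, ‖Ec z‖ ≤ A * Real.exp (-(κ * torusTreeLen Y.1))) ∧
          (∀ t ∈ Ioc (0 : ℝ) γ, Ec t = termC (truncRun K T) j Y (Function.update g i t) ψ)) →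
      ∃ (Hc : ℂ → TDom 4 (domCount (F.P k) M (k' + 1)) → ℂ)
        (Tt : (Z : TDom 4 (domCount (F.P k) M (k' + 1))) →
          Finset (TDom 4 (L * domCount (F.P k) M (k' + 1))) × Finset (TBond 4 M (L * domCount (F.P k) M (k' + 1))) → ℂ → ℂ),
        (∀ Z : (domSys (F.P k) M (k' + 1)).Dom, Z.1 ⊆ X.1 → DifferentiableOn ℂ (fun z => Hc z Z) D) ∧
        (∀ z ∈ D, ∀ Z : TDom 4 (domCount (F.P k) M (k' + 1)), Z.1 ⊆ X.1 → ‖Hc z Z‖ ≤ ∑ t ∈ terms L M Z, ‖Tt Z t z‖) ∧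
        (∀ z ∈ D, ∀ Z : TDom 4 (domCount (F.P k) M (k' + 1)), Z.1 ⊆ X.1 → ∀ t ∈ terms L M Z,
          ‖Tt Z t z‖ ≤ weight L M c Z a t * Real.exp (a₅ * ((Z.1).card : ℝ))) ∧
        (∀ t ∈ Ioc (0 : ℝ) γ, Hc t = ((truncRun K T) k').H (restrictPrefix k' (Function.update g i t)) φ) := by
  intro D hD hdisc k' g hg i hi X φ hφ hlow
  rcases Nat.lt_or_ge k' K with hk | hk
  · -- below the run length: the truncated tower's step `k'` and its lower terms are `T`'s
    obtain ⟨Hc, Tt, hhol, hdom, hterm, hHc⟩ := hbelow D hD hdisc k' hk g hg i hi X φ hφ (fun j hj Y ψ hψ => by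
      obtain ⟨Ec, h₁, h₂, h₃⟩ := hlow j hj Y ψ hψ
      exact ⟨Ec, h₁, h₂, fun t ht => (h₃ t ht).trans (termC_truncRun_of_le T ((Nat.lt_succ_iff.mp hj).trans hk.le) Y _ ψ)⟩)
    refine ⟨Hc, Tt, hhol, hdom, hterm, fun t ht => ?_⟩
    rw [truncRun_of_lt T hk]
    exact hHc t ht
  · -- beyond the run length: the step is termless, `H ≡ 0`
    refine ⟨fun _ _ => 0, fun _ _ _ => 0, fun _ _ => differentiableOn_const 0, ?_, ?_, ?_⟩
    · intro z _ Z _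
      simp
    · intro z _ Z _ t _
      rw [norm_zero]
      exact mul_nonneg (weight_nonneg c Z a hA6 t) (Real.exp_pos _).le
    · intro t _
      funext Z
      rw [truncRun_of_le T hk, H_termlessTower]

end TruncFace

/-! ## §2 The pin-agnostic engine in the fixed-domain currency: `N22At` at any W1 reading -/

section AnyReading

variable {F : T4Family} (θ : Stage12Params F N) {𝔸 : Type*} [NormedRing 𝔸] [NormedAlgebra ℂ 𝔸] [CompleteSpace 𝔸] {G : Type*} [GaugeGroup G]
  {M : ℕ} (D : ReadingData F 𝔸 M) (k : ℕ)
  (Sg : Setting 𝔸 G) (Rz : Residual (F.P k) 𝔸) (logZ : ℕ → GaugeField (F.P k) 0 G → ℝ) (β : ℕ → ℝ → ℝ)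

open Classical in
/-- **`N22At` AT THE LEVEL-`k` BUNDLE OF ANY W1 READING, END TO END, FIXED-DOMAIN CURRENCY** (module 9 §2's `n22At_u3OfRecord₁₂_w1Reading_of_n18Below_stripBound` with STRIP from
module 14′ §4's `stripBound_termC_of_termwise226OnOlder_eHoloAt` for the tower `D.S k` at the space table of record `U^c_j(Y, cs.α₀, cs.α₁)`): readings of the ABSTRACT
run-A backgrounds inside the spaces (`hsp`), the OLDER-coupling level-T hypothesis UNIVERSAL IN THE DOMAIN (N10's lane), an `EHoloAt` family on `sfTowerOfRecord Sg Rz M (D.S k)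
⟨g, β⟩ logZ` (N09's currency), node N18 below `k`, (C1)(C2)(J), the socket numerals + S25 + renewal, the letter signs ⟹ `N22At`. [cite: Balaban1987RG1, (0.23)-(0.25) pp.256-257, Thm 1 p.259 and (1.18) p.263; Balaban1988RG2Cluster, (2.13)-(2.14) pp.14-15, (2.26) p.17 and (2.40)-(2.41) p.21] -/
theorem n22At_u3OfRecord₁₂_w1Reading_of_n18Below_termwise226OnOlder_eHoloAt [NeZero M] {cs : SFConsts}
    (hsp : ∀ (j : ℕ) (U : (D.pairing k).BgA) (Y : (domSys (F.P k) M j).Dom), (D.pairing k).embA U ∈ spaceI Sg Rz M j (domSites (F.P k) M j Y) cs.α₀ cs.α₁)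
    (c : B13.Consts) {L : ℕ} [NeZero L] (hL : 8 ≤ c.L) (hLc : c.L = L) {a a₂ a₂' a₅ Aabs : ℝ}
    (hN : Lemma3Numerics c M ((c.L : ℝ) / 2) a a₂ a₂' a₅ Aabs) {r₁ : ℝ} (hA0 : 0 ≤ c.C3act * c.ε₁) (hr₁ : 0 ≤ r₁) (hκ : D.li.κ ≤ r₁)
    (hrate : r₁ + 2 * (64 * Real.log 162) + 2 ≤ (1 - 8 * c.δ) * ((c.L : ℝ) / 2) * c.κ)
    (hsmall : c.C3act * c.ε₁ * Real.exp (5 * r₁ + 1) * K₀ 64 8 * 9 * 64 ≤ 1)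
    (hrenew : Real.exp 1 * 9 * 64 * K₀ 64 8 ^ 2 * (c.C3act * c.ε₁) ≤ D.li.A) (hγc : θ.γ ≤ cs.γ) (hκc : D.li.κ ≤ cs.κ)
    (h226TOnOlder : ∀ (Dm : Set ℂ), IsOpen Dm → (∀ t ∈ Ioc (0 : ℝ) θ.γ, closedBall (t : ℂ) D.li.r ⊆ Dm) →
      ∀ (k' : ℕ) (g : ℕ → ℝ), g ∈ Window θ.γ → ∀ (i : ℕ), i < k' → ∀ (X : (domSys (F.P k) M (k' + 1)).Dom) (φ : CPair (F.P k) 𝔸),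
      φ ∈ spaceI Sg Rz M (k' + 1) (domSites (F.P k) M (k' + 1) X) cs.α₀ cs.α₁ →
      (∀ (j : ℕ), j < k' + 1 → ∀ (Y : (domSys (F.P k) M j).Dom) (ψ : CPair (F.P k) 𝔸), ψ ∈ spaceI Sg Rz M j (domSites (F.P k) M j Y) cs.α₀ cs.α₁ →
        ∃ Ec : ℂ → ℂ, DifferentiableOn ℂ Ec Dm ∧ (∀ z ∈ Dm, ‖Ec z‖ ≤ D.li.A * Real.exp (-(D.li.κ * torusTreeLen Y.1))) ∧
          (∀ t ∈ Ioc (0 : ℝ) θ.γ, Ec t = termC (D.S k) j Y (Function.update g i t) ψ)) →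
      ∃ (Hc : ℂ → TDom 4 (domCount (F.P k) M (k' + 1)) → ℂ)
        (Tt : (Z : TDom 4 (domCount (F.P k) M (k' + 1))) →
          Finset (TDom 4 (L * domCount (F.P k) M (k' + 1))) × Finset (TBond 4 M (L * domCount (F.P k) M (k' + 1))) → ℂ → ℂ),
        (∀ Z : (domSys (F.P k) M (k' + 1)).Dom, Z.1 ⊆ X.1 → DifferentiableOn ℂ (fun z => Hc z Z) Dm) ∧
        (∀ z ∈ Dm, ∀ Z : TDom 4 (domCount (F.P k) M (k' + 1)), Z.1 ⊆ X.1 → ‖Hc z Z‖ ≤ ∑ t ∈ terms L M Z, ‖Tt Z t z‖) ∧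
        (∀ z ∈ Dm, ∀ Z : TDom 4 (domCount (F.P k) M (k' + 1)), Z.1 ⊆ X.1 → ∀ t ∈ terms L M Z,
          ‖Tt Z t z‖ ≤ weight L M c Z a t * Real.exp (a₅ * ((Z.1).card : ℝ))) ∧
        (∀ t ∈ Ioc (0 : ℝ) θ.γ, Hc t = ((D.S k) k').H (restrictPrefix k' (Function.update g i t)) φ))
    (hE : ∀ g ∈ Window θ.γ, ∀ k' : ℕ, ∃ H : EHoloAt (sfTowerOfRecord Sg Rz M (D.S k) ⟨g, β⟩ logZ) cs k', H.E₀ ≤ D.li.A ∧ D.li.r ≤ H.r)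
    (hfst : ∀ (k : ℕ) (X₁ : Node00.W1.Dom (F.P k) M), ((D.pairing k).pair X₁).1 = X₁.1 + 1)
    (hdj : ∀ (k : ℕ) (X₁ : Node00.W1.Dom (F.P k) M),
      (domSys (F.P (k + 1)) M ((D.pairing k).pair X₁).1).dj ((D.pairing k).pair X₁).2 = (domSys (F.P k) M X₁.1).dj X₁.2)
    (hsurj : ∀ (k : ℕ) (X : Node00.W1.Dom (F.P (k + 1)) M), 1 ≤ X.1 → ∃ X₁ : Node00.W1.Dom (F.P k) M, (D.pairing k).pair X₁ = X)
    (hbg : ∀ (k : ℕ) (U : (D.pairing (k + 1)).BgA), ∃ U₁ : (D.pairing k).BgB, (D.pairing k).embB U₁ = (D.pairing (k + 1)).embA U)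
    (hjunk : ∀ (k : ℕ) (g : ℕ → ℝ) (U : (D.pairing k).BgA) (X : Node00.W1.Dom (F.P k) M), k < X.1 → (D.pairing k).EA (D.S k) g U X = 0)
    (h18 : ∀ k' : ℕ, k' < k → N18At (u3OfRecord₁₂ θ (D.u3Objects θ.γ) k'))
    (hC5 : 0 ≤ D.li.C₅) (hθ1 : D.li.θ₅ < 1) (hC₀' : 2 * D.li.C₅ / (1 - D.li.θ₅) ≤ D.li.C₀)
    (hC₀ : 0 < D.li.C₀) (hθ : 0 < D.li.θ₅) (hA : 0 < D.li.A) (hμ1 : 1 ≤ D.li.μ) (hθμ : D.li.θ₅ ≤ D.li.μ) (hCM : D.li.C₀ ≤ 2 * D.li.A)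
    (hr : 0 < D.li.r) (hγ : 0 < θ.γ) (hs0 : 0 < D.li.s) (hs1 : D.li.s < 1) :
    N22At (u3OfRecord₁₂ θ (D.u3Objects θ.γ) k) :=
  n22At_u3OfRecord₁₂_w1Reading_of_n18Below_stripBound θ D k (fun j Y => spaceI Sg Rz M j (domSites (F.P k) M j Y) cs.α₀ cs.α₁) hsp
    (stripBound_termC_of_termwise226OnOlder_eHoloAt F k Sg Rz logZ β (D.S k) c hL hLc hN hr.le hA0 hr₁ hκ hrate hsmall hrenew hγc hκc h226TOnOlder hE)
    hfst hdj hsurj hbg hjunk h18 hC5 hθ1 hC₀' hC₀ hθ hA hμ1 hθμ hCM hr hγ hs0 hs1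

end AnyReading

/-! ## §3 At the admissible reading of record ON THE TOWERS OF THE RUNS OF RECORD — (J) discharged, inputs below the run length -/

section RunTowers

variable {F : T4Family} {M : ℕ} (S₀ : (k : ℕ) → ClusterTower (F.P k) (MatA N) M)
  (sp : (k j : ℕ) → (domSys (F.P k) M j).Dom → Set (CPair (F.P k) (MatA N)))
  (gauge : (k : ℕ) → GaugeField (F.P k) 0 (Node00.SU N) → GaugeField (F.P k) 0 (Node00.SU N) → ℝ) (hg : ∀ k U U', 0 ≤ gauge k U U')
  (T₀ : (k : ℕ) → GaugeField (F.P (k + 1)) 0 (Node00.SU N) → GaugeField (F.P k) 0 (Node00.SU N))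
  (hT₀ : ∀ (k : ℕ) (U : GaugeField (F.P (k + 1)) 0 (Node00.SU N)),
    (∀ (j : ℕ) (Y : (domSys (F.P (k + 1)) M j).Dom), ofBackgroundC (ιSU N) U ∈ sp (k + 1) j Y) →
    ∀ (j : ℕ) (Y : (domSys (F.P k) M j).Dom), ofBackgroundC (ιSU N) (T₀ k U) ∈ sp k j Y)
  (li : LetterInputs) (θ : Stage12Params F N) (k : ℕ) {G : Type*} [GaugeGroup G]
  (Sg : Setting (MatA N) G) (Rz : Residual (F.P k) (MatA N)) (logZ : ℕ → GaugeField (F.P k) 0 G → ℝ) (β : ℕ → ℝ → ℝ)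

open Classical in
/-- **`N22At` AT THE LEVEL-`k` BUNDLE OF THE ADMISSIBLE READING OF RECORD ON THE TOWERS OF THE RUNS OF RECORD** (`Dr := ReadingData.ofRecordAdm F M N (runTowers S₀) sp gauge hg
T₀ hT₀ li`).  The readings clause is GONE (by type: `U.2 j Y` and the INCLUSION `hspk` of the run-length-`k` table in the space table of record of `Sg` at `cs`'s radii), the
pairing coherence is GONE (module 13 §1), the junk-freeness pin is GONE (`termlessBeyond_runTowers`: the run of `k` steps creates no term after step `k`); the OLDER-coupling
level-T hypothesis UNIVERSAL IN THE DOMAIN (N10's lane) and the `EHoloAt` family on `sfTowerOfRecord Sg Rz M (S₀ k) ⟨g, β⟩ logZ` (N09's currency) are asked for the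
UNTRUNCATED tower `S₀ k` AT THE LEVELS `k′ < k` ONLY (§1, `exists_eHoloAt_truncRun_of_lt`); with `∀ k′ < k, N18At (…)` (N18), the socket numerals + S25 + renewal and the letter
signs ⟹ `N22At (u3OfRecord₁₂ θ (Dr.u3Objects θ.γ) k)`. [cite: Balaban1987RG1, (0.23)-(0.25) pp.256-257, Thm 1 p.259 and (1.18) p.263; Balaban1988RG2Cluster, (2.13)-(2.14) pp.14-15, (2.26) p.17 and (2.40)-(2.41) p.21] -/
theorem n22At_u3OfRecord₁₂_ofRecordAdm_runTowers_of_n18Below_termwise226OnOlder_eHoloAt [NeZero M] {cs : SFConsts}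
    (hspk : ∀ (j : ℕ) (Y : (domSys (F.P k) M j).Dom), sp k j Y ⊆ spaceI Sg Rz M j (domSites (F.P k) M j Y) cs.α₀ cs.α₁)
    (c : B13.Consts) {L : ℕ} [NeZero L] (hL : 8 ≤ c.L) (hLc : c.L = L) {a a₂ a₂' a₅ Aabs : ℝ}
    (hN : Lemma3Numerics c M ((c.L : ℝ) / 2) a a₂ a₂' a₅ Aabs) {r₁ : ℝ} (hA0 : 0 ≤ c.C3act * c.ε₁) (hr₁ : 0 ≤ r₁) (hκ : li.κ ≤ r₁)
    (hrate : r₁ + 2 * (64 * Real.log 162) + 2 ≤ (1 - 8 * c.δ) * ((c.L : ℝ) / 2) * c.κ)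
    (hsmall : c.C3act * c.ε₁ * Real.exp (5 * r₁ + 1) * K₀ 64 8 * 9 * 64 ≤ 1)
    (hrenew : Real.exp 1 * 9 * 64 * K₀ 64 8 ^ 2 * (c.C3act * c.ε₁) ≤ li.A) (hγc : θ.γ ≤ cs.γ) (hκc : li.κ ≤ cs.κ)
    (h226TOnOlder : ∀ (Dm : Set ℂ), IsOpen Dm → (∀ t ∈ Ioc (0 : ℝ) θ.γ, closedBall (t : ℂ) li.r ⊆ Dm) →
      ∀ (k' : ℕ), k' < k → ∀ (g : ℕ → ℝ), g ∈ Window θ.γ → ∀ (i : ℕ), i < k' →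
      ∀ (X : (domSys (F.P k) M (k' + 1)).Dom) (φ : CPair (F.P k) (MatA N)),
      φ ∈ spaceI Sg Rz M (k' + 1) (domSites (F.P k) M (k' + 1) X) cs.α₀ cs.α₁ →
      (∀ (j : ℕ), j < k' + 1 → ∀ (Y : (domSys (F.P k) M j).Dom) (ψ : CPair (F.P k) (MatA N)), ψ ∈ spaceI Sg Rz M j (domSites (F.P k) M j Y) cs.α₀ cs.α₁ →
        ∃ Ec : ℂ → ℂ, DifferentiableOn ℂ Ec Dm ∧ (∀ z ∈ Dm, ‖Ec z‖ ≤ li.A * Real.exp (-(li.κ * torusTreeLen Y.1))) ∧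
          (∀ t ∈ Ioc (0 : ℝ) θ.γ, Ec t = termC (S₀ k) j Y (Function.update g i t) ψ)) →
      ∃ (Hc : ℂ → TDom 4 (domCount (F.P k) M (k' + 1)) → ℂ)
        (Tt : (Z : TDom 4 (domCount (F.P k) M (k' + 1))) →
          Finset (TDom 4 (L * domCount (F.P k) M (k' + 1))) × Finset (TBond 4 M (L * domCount (F.P k) M (k' + 1))) → ℂ → ℂ),
        (∀ Z : (domSys (F.P k) M (k' + 1)).Dom, Z.1 ⊆ X.1 → DifferentiableOn ℂ (fun z => Hc z Z) Dm) ∧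
        (∀ z ∈ Dm, ∀ Z : TDom 4 (domCount (F.P k) M (k' + 1)), Z.1 ⊆ X.1 → ‖Hc z Z‖ ≤ ∑ t ∈ terms L M Z, ‖Tt Z t z‖) ∧
        (∀ z ∈ Dm, ∀ Z : TDom 4 (domCount (F.P k) M (k' + 1)), Z.1 ⊆ X.1 → ∀ t ∈ terms L M Z,
          ‖Tt Z t z‖ ≤ weight L M c Z a t * Real.exp (a₅ * ((Z.1).card : ℝ))) ∧
        (∀ t ∈ Ioc (0 : ℝ) θ.γ, Hc t = ((S₀ k) k').H (restrictPrefix k' (Function.update g i t)) φ))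
    (hE : ∀ g ∈ Window θ.γ, ∀ k' : ℕ, k' + 1 ≤ k → ∃ H : EHoloAt (sfTowerOfRecord Sg Rz M (S₀ k) ⟨g, β⟩ logZ) cs k', H.E₀ ≤ li.A ∧ li.r ≤ H.r)
    (h18 : ∀ k' : ℕ, k' < k → N18At (u3OfRecord₁₂ θ ((ReadingData.ofRecordAdm F M N (runTowers S₀) sp gauge hg T₀ hT₀ li).u3Objects θ.γ) k'))
    (hC5 : 0 ≤ li.C₅) (hθ1 : li.θ₅ < 1) (hC₀' : 2 * li.C₅ / (1 - li.θ₅) ≤ li.C₀)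
    (hC₀ : 0 < li.C₀) (hθ : 0 < li.θ₅) (hA : 0 < li.A) (hμ1 : 1 ≤ li.μ) (hθμ : li.θ₅ ≤ li.μ) (hCM : li.C₀ ≤ 2 * li.A)
    (hr : 0 < li.r) (hγ : 0 < θ.γ) (hs0 : 0 < li.s) (hs1 : li.s < 1) :
    N22At (u3OfRecord₁₂ θ ((ReadingData.ofRecordAdm F M N (runTowers S₀) sp gauge hg T₀ hT₀ li).u3Objects θ.γ) k) := by
  obtain ⟨hfst, hdj, hsurj, hbg⟩ := pairingCoherence_ofRecordAdm (N := N) (runTowers S₀) sp gauge hg T₀ hT₀ li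
  refine n22At_u3OfRecord₁₂_w1Reading_of_n18Below_termwise226OnOlder_eHoloAt θ (ReadingData.ofRecordAdm F M N (runTowers S₀) sp gauge hg T₀ hT₀ li) k Sg Rz
    logZ β (fun j U Y => hspk j Y (U.2 j Y)) c hL hLc hN hA0 hr₁ hκ hrate hsmall hrenew hγc hκc
    (termwise226OnOlder_truncRun k Sg Rz (S₀ k) k c (mul_nonneg hN.hα₆.le hN.hε₀) h226TOnOlder)
    (exists_eHoloAt_truncRun_of_lt Sg Rz (S₀ k) logZ cs β hA.le hr k hE) hfst hdj hsurj hbg (fun k₁ h U₁ X₁ hk₁ => ?_) h18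
    hC5 hθ1 hC₀' hC₀ hθ hA hμ1 hθμ hCM hr hγ hs0 hs1
  show (functionalC (runTowers S₀ k₁) h (ofBackgroundC (ιSU N) U₁.1) X₁).re = 0
  rw [(termlessBeyond_runTowers S₀ k₁).functionalC_eq_zero h _ X₁ hk₁, Complex.zero_re]

end RunTowers

/-! ## §4 THE ₁₂ EDGE N18 → N22 AT THE ADMISSIBLE READING OF RECORD ON THE TOWERS OF THE RUNS OF RECORD (edition-1 home) -/

section RunTowersEdge

variable (S₀ : (F : T4Family) → (θ : Stage12Params F N) → (k : ℕ) → ClusterTower (F.P k) (MatA N) θ.τ9.M)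
  (sp : (F : T4Family) → (θ : Stage12Params F N) → (k j : ℕ) → (domSys (F.P k) θ.τ9.M j).Dom → Set (CPair (F.P k) (MatA N)))
  (gauge : (F : T4Family) → (θ : Stage12Params F N) → (k : ℕ) → GaugeField (F.P k) 0 (Node00.SU N) → GaugeField (F.P k) 0 (Node00.SU N) → ℝ)
  (hg : ∀ (F : T4Family) (θ : Stage12Params F N) (k : ℕ) (U U' : GaugeField (F.P k) 0 (Node00.SU N)), 0 ≤ gauge F θ k U U')
  (T₀ : (F : T4Family) → (θ : Stage12Params F N) → (k : ℕ) → GaugeField (F.P (k + 1)) 0 (Node00.SU N) → GaugeField (F.P k) 0 (Node00.SU N))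
  (hT : ∀ (F : T4Family) (θ : Stage12Params F N) (k : ℕ) (U : GaugeField (F.P (k + 1)) 0 (Node00.SU N)),
    (∀ (j : ℕ) (Y : (domSys (F.P (k + 1)) θ.τ9.M j).Dom), ofBackgroundC (ιSU N) U ∈ sp F θ (k + 1) j Y) →
      ∀ (j : ℕ) (X : (domSys (F.P k) θ.τ9.M j).Dom), ofBackgroundC (ιSU N) (T₀ F θ k U) ∈ sp F θ k j X)
  (li : (F : T4Family) → Stage12Params F N → LetterInputs) (ℓ₃ : T4Family → Node00.NE3Letters₁₁)
  (ne2 : (F : T4Family) → Stage12Params F N → (ℕ → ℝ) → List (ULoop F) → ℕ → Node00.NE2Objects₁₁)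
  (ne1 : (F : T4Family) → Stage12Params F N → (ℕ → ℝ) → List (ULoop F) → NE1pCarriers) {G : Type*} [GaugeGroup G]

open Classical in
/-- **THE EDGE N18 → N22 AT THE ADMISSIBLE READING OF RECORD ON THE TOWERS OF THE RUNS OF RECORD** (dag-n22-e's edition-1 home `readingOfRecord₁₂ w1 ℓ₃ ne2 ne1` at
`w1 := fun F θ ↦ ReadingData.ofRecordAdm F θ.τ9.M N (runTowers (S₀ F θ)) (sp F θ) (gauge F θ) (hg F θ) (T₀ F θ) (hT F θ) (li F θ)` — dag-n18-d g3's `s_N18_readingAdm₁₂_iff`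
home at `S F θ := runTowers (S₀ F θ)`).  Node N18's stub `S_N18 (RRec₁₂ 𝔯)` + per admissible Stage-12 tuple with provisos: the letter signs, and per run length `k` the
EXISTENCE of: `NeZero θ.τ9.M`, a §2 setting `Sg : Sect2.Setting (M_N(ℂ)) G` with residual recipes `Rz`, normalizations `logZ`, `β`, N09 letters `cs` with `θ.γ ≤ cs.γ`,
`li.κ ≤ cs.κ` and the run-length-`k` table INSIDE the space table of record `U^c_j(Y, cs.α₀, cs.α₁)`, socket constants `c` with `8 ≤ c.L`, `L = c.L` with `NeZero L`,
`Lemma3Numerics c θ.τ9.M (½c.L) a a₂ a₂′ a₅ Aabs`, `0 ≤ C₃ε₁`, `0 ≤ r₁`, `li.κ ≤ r₁`, S25's two clauses, the renewal, the OLDER-coupling level-T hypothesis UNIVERSAL IN THE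
DOMAIN for `S₀ F θ k` BELOW THE RUN LENGTH (N10's lane) and an `EHoloAt` family on `sfTowerOfRecord Sg Rz θ.τ9.M (S₀ F θ k) ⟨g, β⟩ logZ` BELOW THE RUN LENGTH with
`H.E₀ ≤ li.A`, `li.r ≤ H.r` (N09's currency) ⟹ node N22's stub `S_N22 (RRec₁₂ 𝔯)`.  NO coherence clause, NO junk-freeness clause, NO readings clause.  Module 12 §2's datum
form (`s_N22_rRec₁₂_w1_iff`, layer B's `s_N18_rRec₁₂_iff`) at `𝔇 := pinnedInputs₁₂ w1 ℓ₃ ne2`, then §3. [cite: Balaban1987RG1, (0.23)-(0.25) pp.256-257, Thm 1 p.259 and (1.18) p.263; Balaban1988RG2Cluster, (2.13)-(2.14) pp.14-15, (2.26) p.17 and (2.40)-(2.41) p.21] -/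
theorem s_N22_readingOfRecord₁₂_ofRecordAdm_runTowers_of_s_N18_termwise226OnOlder_eHoloAt
    (h18 : S_N18 (RRec₁₂ (readingOfRecord₁₂
      (fun F θ => ReadingData.ofRecordAdm F θ.τ9.M N (runTowers (S₀ F θ)) (sp F θ) (gauge F θ) (hg F θ) (T₀ F θ) (hT F θ) (li F θ)) ℓ₃ ne2 ne1)))
    (hnum : ∀ (F : T4Family) (θ : Stage12Params F N), θ.Provisos₁₂ F N → θ.Admissible F N →
      0 < (li F θ).C₀ ∧ 0 < (li F θ).θ₅ ∧ (li F θ).θ₅ < 1 ∧ 0 ≤ (li F θ).C₅ ∧ 2 * (li F θ).C₅ / (1 - (li F θ).θ₅) ≤ (li F θ).C₀ ∧ 0 < (li F θ).A ∧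
        (li F θ).θ₅ ≤ (li F θ).μ ∧ (li F θ).C₀ ≤ 2 * (li F θ).A ∧ 0 < (li F θ).r ∧ 0 < (li F θ).s ∧ (li F θ).s < 1 ∧ 1 ≤ (li F θ).μ)
    (hdata : ∀ (F : T4Family) (θ : Stage12Params F N), θ.Provisos₁₂ F N → θ.Admissible F N → ∀ (k : ℕ),
      ∃ (_ : NeZero θ.τ9.M) (Sg : Setting (MatA N) G) (Rz : Residual (F.P k) (MatA N)) (logZ : ℕ → GaugeField (F.P k) 0 G → ℝ) (β : ℕ → ℝ → ℝ)
        (cs : SFConsts) (c : B13.Consts) (L : ℕ) (_ : NeZero L) (a a₂ a₂' a₅ Aabs r₁ : ℝ),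
        (∀ (j : ℕ) (Y : (domSys (F.P k) θ.τ9.M j).Dom), sp F θ k j Y ⊆ spaceI Sg Rz θ.τ9.M j (domSites (F.P k) θ.τ9.M j Y) cs.α₀ cs.α₁) ∧
        8 ≤ c.L ∧ c.L = L ∧ Lemma3Numerics c θ.τ9.M ((c.L : ℝ) / 2) a a₂ a₂' a₅ Aabs ∧ 0 ≤ c.C3act * c.ε₁ ∧ 0 ≤ r₁ ∧ (li F θ).κ ≤ r₁ ∧
        r₁ + 2 * (64 * Real.log 162) + 2 ≤ (1 - 8 * c.δ) * ((c.L : ℝ) / 2) * c.κ ∧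
        c.C3act * c.ε₁ * Real.exp (5 * r₁ + 1) * K₀ 64 8 * 9 * 64 ≤ 1 ∧
        Real.exp 1 * 9 * 64 * K₀ 64 8 ^ 2 * (c.C3act * c.ε₁) ≤ (li F θ).A ∧ θ.γ ≤ cs.γ ∧ (li F θ).κ ≤ cs.κ ∧
        (∀ (Dm : Set ℂ), IsOpen Dm → (∀ t ∈ Ioc (0 : ℝ) θ.γ, closedBall (t : ℂ) (li F θ).r ⊆ Dm) →
          ∀ (k' : ℕ), k' < k → ∀ (g : ℕ → ℝ), g ∈ Window θ.γ → ∀ (i : ℕ), i < k' →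
          ∀ (X : (domSys (F.P k) θ.τ9.M (k' + 1)).Dom) (φ : CPair (F.P k) (MatA N)),
          φ ∈ spaceI Sg Rz θ.τ9.M (k' + 1) (domSites (F.P k) θ.τ9.M (k' + 1) X) cs.α₀ cs.α₁ →
          (∀ (j : ℕ), j < k' + 1 → ∀ (Y : (domSys (F.P k) θ.τ9.M j).Dom) (ψ : CPair (F.P k) (MatA N)),
            ψ ∈ spaceI Sg Rz θ.τ9.M j (domSites (F.P k) θ.τ9.M j Y) cs.α₀ cs.α₁ →
            ∃ Ec : ℂ → ℂ, DifferentiableOn ℂ Ec Dm ∧ (∀ z ∈ Dm, ‖Ec z‖ ≤ (li F θ).A * Real.exp (-((li F θ).κ * torusTreeLen Y.1))) ∧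
              (∀ t ∈ Ioc (0 : ℝ) θ.γ, Ec t = termC (S₀ F θ k) j Y (Function.update g i t) ψ)) →
          ∃ (Hc : ℂ → TDom 4 (domCount (F.P k) θ.τ9.M (k' + 1)) → ℂ)
            (Tt : (Z : TDom 4 (domCount (F.P k) θ.τ9.M (k' + 1))) →
              Finset (TDom 4 (L * domCount (F.P k) θ.τ9.M (k' + 1))) × Finset (TBond 4 θ.τ9.M (L * domCount (F.P k) θ.τ9.M (k' + 1))) → ℂ → ℂ),
            (∀ Z : (domSys (F.P k) θ.τ9.M (k' + 1)).Dom, Z.1 ⊆ X.1 → DifferentiableOn ℂ (fun z => Hc z Z) Dm) ∧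
            (∀ z ∈ Dm, ∀ Z : TDom 4 (domCount (F.P k) θ.τ9.M (k' + 1)), Z.1 ⊆ X.1 → ‖Hc z Z‖ ≤ ∑ t ∈ terms L θ.τ9.M Z, ‖Tt Z t z‖) ∧
            (∀ z ∈ Dm, ∀ Z : TDom 4 (domCount (F.P k) θ.τ9.M (k' + 1)), Z.1 ⊆ X.1 → ∀ t ∈ terms L θ.τ9.M Z,
              ‖Tt Z t z‖ ≤ weight L θ.τ9.M c Z a t * Real.exp (a₅ * ((Z.1).card : ℝ))) ∧
            (∀ t ∈ Ioc (0 : ℝ) θ.γ, Hc t = ((S₀ F θ k) k').H (restrictPrefix k' (Function.update g i t)) φ)) ∧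
        (∀ g ∈ Window θ.γ, ∀ k' : ℕ, k' + 1 ≤ k →
          ∃ H : EHoloAt (sfTowerOfRecord Sg Rz θ.τ9.M (S₀ F θ k) ⟨g, β⟩ logZ) cs k', H.E₀ ≤ (li F θ).A ∧ (li F θ).r ≤ H.r)) :
    S_N22 (RRec₁₂ (readingOfRecord₁₂
      (fun F θ => ReadingData.ofRecordAdm F θ.τ9.M N (runTowers (S₀ F θ)) (sp F θ) (gauge F θ) (hg F θ) (T₀ F θ) (hT F θ) (li F θ)) ℓ₃ ne2 ne1)) := by
  refine (YMDAG.N22.s_N22_rRec₁₂_w1_iff (pinnedInputs₁₂ (fun F θ => ReadingData.ofRecordAdm F θ.τ9.M N (runTowers (S₀ F θ)) (sp F θ) (gauge F θ) (hg F θ)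
    (T₀ F θ) (hT F θ) (li F θ)) ℓ₃ ne2) ne1).2 fun F D h k => ?_
  have h18' : ∀ k' : ℕ, N18At (u3OfRecord₁₂ h.params
      ((ReadingData.ofRecordAdm F h.params.τ9.M N (runTowers (S₀ F h.params)) (sp F h.params) (gauge F h.params) (hg F h.params) (T₀ F h.params)
        (hT F h.params) (li F h.params)).u3Objects h.params.γ) k') :=
    fun k' => (s_N18_rRec₁₂_iff (readingOfRecord₁₂ (fun F θ => ReadingData.ofRecordAdm F θ.τ9.M N (runTowers (S₀ F θ)) (sp F θ) (gauge F θ) (hg F θ)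
      (T₀ F θ) (hT F θ) (li F θ)) ℓ₃ ne2 ne1)).1 h18 F D h (fun _ => 0) [] k'
  obtain ⟨hC₀, hθ, hθ1, hC5, hC₀', hA, hθμ, hCM, hr, hs0, hs1, hμ1⟩ := hnum F h.params h.provisos h.admissible
  obtain ⟨hMz, Sg, Rz, logZ, β, cs, c, L, hLz, a, a₂, a₂', a₅, Aabs, r₁, hspk, hL, hLc, hN, hA0, hr₁, hκ, hrate, hsmall, hrenew, hγc, hκc, h226TOnOlder, hE⟩ :=
    hdata F h.params h.provisos h.admissible k
  exact n22At_u3OfRecord₁₂_ofRecordAdm_runTowers_of_n18Below_termwise226OnOlder_eHoloAt (S₀ F h.params) (sp F h.params) (gauge F h.params) (hg F h.params)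
    (T₀ F h.params) (hT F h.params) (li F h.params) h.params k Sg Rz logZ β hspk c hL hLc hN hA0 hr₁ hκ hrate hsmall hrenew hγc hκc h226TOnOlder hE
    (fun k' _ => h18' k') hC5 hθ1 hC₀' hC₀ hθ hA hμ1 hθμ hCM hr h.gamma_pos hs0 hs1

end RunTowersEdge

end YMDAG.N22.W1

end
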